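import Literature.AnabelianGeometry.EtaleTheta.Discharge.Sec5OfBiKummerDataKummer
import Literature.AnabelianGeometry.EtaleTheta.Discharge.Sec5EnvelopeTopology

/-!
# [EtTh] Prop. 5.2 (iii), Frobenioid half, for the ASSEMBLED §5 data: the bi-Kummer difference of `(s^⊓-gp_N, s^⊔-gp_N)` IS the Kummer
# cocycle of the root FUNCTION `f_N|_{B_N}` (Prop. 4.3 (iii) p. 317, Prop. 5.2 (i)/(iii) p. 324, §5 p. 331 / PDF pp. 91, 98, 105) — FILE 1 of 2

Mochizuki, *The étale theta function and its Frobenioid-theoretic manifestations*, Publ. RIMS **45** (2009) [MochizukiEtTh2009].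
Prop. 4.3 (iii) p.317 (PDF p.91): «the difference `s′_N{}^{gp}·(s″_N{}^{gp})⁻¹` determines a twisted homomorphism `H_{B_N} → μ_N(B_N)`,
hence an element of … `H¹(H_{B_N}, μ_N(B_N))`, which is equal to the Kummer class [cf. [Mzk18], Definition 2.1, (ii)] `κ_{f|_{B_N}}` …
of `f|_{B_N}`»; Prop. 5.2 (i) p.324 (PDF p.98): «The pair of morphisms of `C` determined by "`s_{l·N}`", "`τ_{l·N}`" constitutes … an
`N`-th root of a right fraction-pair … of [the Frobenioid-theoretic version of …] an `l`-th root of the theta function `Θ̈`»; (iii):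
«The Kummer class determined by the bi-Kummer `N`-th root … corresponds precisely to the reduction modulo `N` of the class `η̲̈^Θ` …
relative to the natural isomorphism … between "`μ_N(−)`" and `(l·Δ_Θ) ⊗ (ℤ/Nℤ)`», proof: «These assertions follow immediately from
the definitions».  [cite: MochizukiEtTh2009, Prop 4.3 (iii) p.317 (PDF p.91); Prop 5.2 (iii) p.324 (PDF p.98); §5 p.331 (PDF p.105)]

abc-iut cell, layer L2, seat abc-iut-L2-t4 (gen 5; §5 owner lineage, row W3-L2-01), abc-iut-L2-lead (gen 4) row R353 **R-C3
«Prop 5.2 (iii) AT ofConnectedTemperoidData»** (abc-iut-L2-d4's Thm 5.7 residual (C3), memo `HOME/staging/L2/L2-d4/SHAPES-Thm57-residual-C.md`).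
PROOF-ONLY (0 `def`s, no instance, no `Prop` fact; nothing landed is edited or restated).  FILE 1 (this file): the ASSEMBLED data
`ofBiKummerData` over any §4 setting (dictionary form) + generic bookkeeping; FILE 2 (`Sec5Prop52iiiRootKummerOfConnectedTemperoid.lean`):
the GENUINE connected data over `B^temp(Π^tp_X)⁰` (laws discharged) and «Prop. 5.2 (iii) ⟺ a clause on the root function alone».

WHAT IS PROVED.  Print's proof of Prop. 5.2 (iii) has two halves: (α) the bi-Kummer class of the root `(s_N, τ_N)` IS the Kummer class
of the function `f_N|_{B_N}` (Prop. 4.3 (iii), second clause) and (β) `f_N` is [the Frobenioid-theoretic version of] a root of `Θ̈`, whose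
Kummer class IS `η̲̈^Θ` mod `N` (Prop. 1.3's definition of the étale theta class).  In the tree (β) is the irreducible JUNCTION «`θ := Θ̈`»
(GAP-LEDGER G-L2t4-2; abc-iut-f-125's `exists_thetaSectionCompat_mem_…_iff`: F-0521 ⟺ `(m∘d)⁻¹ ∈ thetaCocycles`), because the §5 data's
tempered Frobenioid `tf` and its function `θ` are abstract binders.  (α), however, had been proved only for abc-iut-L2-t3's §4 structure
`BiKummerRoot` over `mkOfModel` (`Discharge/Sec4Prop43iiiKummerClass.lean`, `biratAut_restrict_mkOfModel` — consumed by no `Sec5*` file),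
not for the §5 carriers, whose sections `s^⊓-gp_N, s^⊔-gp_N` are the unique lifts `liftAlong` of p.331.  Here:
* `toB_biratAut_sgpCap_restrict_ofBiKummerData` — for the ASSEMBLED §5 data `ofBiKummerData …` over any §4 setting `S` (dictionary
  `toB : O^×(A^birat) ↪ B(A_D)^×` with its [FrdI] Thm. 5.2 (ii) laws `hfrac`/`haut`/`hres`, as in abc-iut-L6-t12's / my gen-3 files): for
  `y ∈ Π^tp_Ÿ`, **`s^⊓-gp_N(ρ y) · g_B = u_{ω_y} · g_B`** in `B(B_N^bs)`, where `g_B := f_N|_{B_N}` (`restrictAlong s^⊓_N f_N`), `·` is the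
  birational action of `Aut_C(B_N)` ([FrdII] Def. 2.1 (i); tree convention `h·g = ζ_h·g`), and `ω_y := s^⊔-gp_N(ρ y)·s^⊓-gp_N(ρ y)⁻¹ ∈ O^×(B_N)`
  is the bi-Kummer difference in abc-iut-L2-t11's orientation (`diffCocycle`, `Sec5EnvelopeTopology.lean`) — so «the Kummer cocycle of the
  root function under the Galois action THROUGH `s^⊓-gp_N` IS the bi-Kummer difference» (sign exactly as in `Sec4Prop43iiiKummerClass`'s note
  «`ζ_h = u_{s″(h)·s′(h)⁻¹}`»).  Inputs: NONE beyond the dictionary laws and the section property `hσ` — no `hH`, no `H : Facts`;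
* `biratAutModel_sgpCap_restrict_ofConnectedTemperoidData` — the same at the GENUINE connected data over `B^temp(Π^tp_X)⁰`
  (`toB = id`; `hfrac`/`haut`/`hres` DISCHARGED by abc-iut-L2-t9's model formulas, `hσ` by `baseMap_strvOfBiKummerData`): unconditional
  given `h` ([FrdI] Thm. 5.2 hypotheses of the data);
* `unitsToRatFn_diffCocycle_mul_restrict_ofConnectedTemperoidData` — the same with `ω_y` packaged as abc-iut-L2-t11's `diffCocycle H y`;
* `eq_diffCocycle_of_biratAutModel_sgpCap_restrict` — UNIQUENESS: `ζ ∈ O^×(B_N)` with `s^⊓-gp_N(ρ y)·g_B = u_ζ·g_B` IS `ω_y` (`B(B_N^bs)`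
  cancellative, `O^×(B_N) ↪ B` injective — `Φ` divisorial);
* `thetaSectionCompat_iff_rootKummer_ofConnectedTemperoidData` — hence Prop. 5.2 (iii)'s dictionary F-0521 (`ThetaSectionCompat … η`) AT THE
  GENUINE DATA is EQUIVALENT to a clause on the ROOT FUNCTION ALONE: «`∀ y ∈ Π^tp_Ÿ̲`, `s^⊓-gp_N(ρ y)·g_B = u_{m⁻¹(η(ι y))⁻¹}·g_B`» — print's
  (β) in Kummer currency; and `prop52iii_printOrientation_ofConnectedTemperoidData`: the lead's wording «`s^⊓-gp_N·s^⊔-gp_N⁻¹ = ρ_N^* η^Θ_N` in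
  `μ_N(B_N)` via [the identification `m`]» from F-0521 (orientation bookkeeping only).
HONEST RESIDUAL (unchanged, re-stated in function currency): whether the Kummer cocycle of `g_B` read through `m` is a theta cocycle of
the §2 model — the junction «`θ := Θ̈`» (G-L2t4-2), PROVABLE exactly when a geometric `tf` supplies `Θ̈ ∈ B(Ÿ̲̲)` with Prop. 1.3's class
(FOUNDATIONS rows 13–14; §1 side: abc-iut-L2-t12's `ThetaKummerInput.kummerTheta` / `IsThetaKummer`).  «via Prop 5.5»: `m` is generic here;
a consumer may take the Prop. 5.5 identification.  Kernel-checked consequences for data so typed; nothing asserts these data exist for an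
actual curve; no side is taken on [IUTchIII] Cor. 3.12; typed ≠ proved for every named input.
-/

noncomputable section

namespace Literature.AnabelianGeometry.EtaleTheta

open CategoryTheory Opposite Literature.AlgebraicGeometry.Frobenioids
open Literature.AlgebraicGeometry.Frobenioids.PreFrobenioid (pull_injective)

universe u₀ v₀ u v w

namespace ThetaFrobenioid

/-- Commutative-monoid bookkeeping used below (stated on variables so that AC-normalisation is instant).
[cite: MochizukiFrdI2008, Thm. 5.2(i) p.100] -/
private theorem mul_mul_mul_comm4 {M : Type*} [CommMonoid M] (a x p c : M) : a * x * (p * c) = p * a * x * c := by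
  simp only [mul_comm, mul_left_comm]

/-! ## §1. The assembled data `ofBiKummerData` (dictionary form) -/

section Assembled

variable {K : Type u₀} [Field K] {X : SemiGraphs.TemperedArithmeticGroup.{u₀} K} {D₀ : Type u₀} [Category.{v₀} D₀]
  {V : FrdIMonoidStub.{w}} {T₀ : RealifiedDivisorMonoids (D₀ := D₀) V} {D : Type u} [Category.{v} D]
  {VD : FrdICatStub.{u, v, w} D} {S : BiKummerSetting X T₀ D VD}
  {pullFrac : ∀ {A A' : S.C} (_ : A' ⟶ A), S.biratUnits A → S.biratUnits A'}
  {lv N : ℕ+} {T : ThetaEnvData.{max v w} N} {θ : S.biratUnits S.Aodot} {Bl : S.C}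
  {Pl : S.FractionPair θ Bl} {Rl : S.NthRoot θ Pl lv pullFrac}
  (h : ModelFrobenioid.Hypotheses S.tf.divisorMonoid S.tf.ratFnFunctor)
  (toB : ∀ A : S.C, S.biratUnits A →* S.tf.biratUnitsModel A) (Q : FrobenioidTheta.ThetaSubquotientStub.{w} D)
  (odd_l : Odd (lv : ℕ)) (R : S.NthRoot Rl.root Rl.pair N pullFrac) (ιX : T.PiX ≃ₜ* X.Pi)
  (hopen : IsOpen ((S.galoisSurj R.AN.base R.αData.isGalois).ker : Set X.Pi)) (σ : Aut R.AN.base →* Aut R.AN)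
  (K' : Type w) [Field K'] (constEmb : K'ˣ →* S.tf.biratUnitsModel R.BN)
  (constEmb_injective : Function.Injective constEmb)
  (hdivc : ∀ g : Aut R.BN.base,
    ModelFrobenioid.div ((σ ((BiKummerSetting.NthRoot.baseIso S R).conjAut.symm g)).hom ≫ R.pair.num) =
      ModelFrobenioid.div R.pair.num)
  (hdivp : ∀ y : T.PiYdd,
    ModelFrobenioid.div ((σ (S.galoisSurj R.AN.base R.αData.isGalois (ιX y.1))).hom ≫ R.pair.den) =
      ModelFrobenioid.div R.pair.den)

/-- **Prop. 4.3 (iii), second clause / Prop. 5.2 (iii), Frobenioid half, for the ASSEMBLED §5 data** (dictionary form): for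
`y ∈ Π^tp_Ÿ`, the section `s^⊓-gp_N(ρ y)` acts on the restricted root function `g_B := f_N|_{B_N}` by multiplication by the rational
function `u_{ω_y}` of the bi-Kummer difference `ω_y := s^⊔-gp_N(ρ y)·s^⊓-gp_N(ρ y)⁻¹` — «the Kummer class … `κ_{f|_{B_N}}`» (p.317).  From my
gen-3 identity `pull_unit_sgpCap_mul_root` at `y⁻¹` and the [FrdI] Thm. 5.2 (i) unit bookkeeping of `ω_y` (`unit_comp`).  Dictionary laws:
`hfrac` (fractions), `haut` (the action is `Base(σ⁻¹)^*`), `hres` (`f ↦ f|_B` is `(Base s)⁻¹{}^*`); `hσ` = [FrdI] Prop. 5.6 section property.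
[cite: MochizukiEtTh2009, Prop 4.3 (iii) p.317 (PDF p.91); §5 p.331 (PDF p.105)] -/
theorem toB_biratAut_sgpCap_restrict_ofBiKummerData
    (hσ : ∀ g : Aut R.AN.base, ModelFrobenioid.baseMap (σ g).hom = g.hom)
    (hfrac : ∀ {A B : S.C} (s' s'' : A ⟶ B) (h' : S.IsPreStep s') (h'' : S.IsPreStep s'')
      (hb : PreFrobenioid.BaseEquivalent S.F s' s''),
      (toB A (S.fracOf s' s'' h' h'' hb) : S.tf.ratFnFunctor.obj (op A.base)) *
        ModelFrobenioid.unit s'' = ModelFrobenioid.unit s')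
    (haut : ∀ {A : S.C} (e : Aut A) (x : S.biratUnits A),
      (toB A (S.biratAut A e x) : S.tf.ratFnFunctor.obj (op A.base)) =
        pull S.tf.ratFnFunctor (ModelFrobenioid.baseMap e.inv) (toB A x : S.tf.ratFnFunctor.obj (op A.base)))
    (hres : ∀ {A B : S.C} (s : A ⟶ B) (hs : S.IsPreStep s) (x : S.biratUnits A),
      haveI : IsIso (ModelFrobenioid.baseMap s) := hs.2
      (toB B (S.restrictAlong s hs x) : S.tf.ratFnFunctor.obj (op B.base)) =
        pull S.tf.ratFnFunctor (inv (ModelFrobenioid.baseMap s)) (toB A x : S.tf.ratFnFunctor.obj (op A.base)))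
    (y : T.PiX) (hy : y ∈ T.PiYdd) :
    (toB R.BN (S.biratAut R.BN
        ((ofBiKummerData h toB Q odd_l R ιX hopen σ K' constEmb constEmb_injective hdivc hdivp).sgpCap
          (rhoOfBiKummerData R ιX y))
        (S.restrictAlong R.pair.num R.pair.isPreStep_num R.root)) : S.tf.ratFnFunctor.obj (op R.BN.base)) =
      (ModelFrobenioid.unit
          (((ofBiKummerData h toB Q odd_l R ιX hopen σ K' constEmb constEmb_injective hdivc hdivp).sgpCup
              ⟨rhoOfBiKummerData R ιX y, Subgroup.mem_map_of_mem _ hy⟩ *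
            ((ofBiKummerData h toB Q odd_l R ιX hopen σ K' constEmb constEmb_injective hdivc hdivp).sgpCap
              (rhoOfBiKummerData R ιX y))⁻¹ : Aut R.BN).hom) : S.tf.ratFnFunctor.obj (op R.BN.base)) *
        (toB R.BN (S.restrictAlong R.pair.num R.pair.isPreStep_num R.root) : S.tf.ratFnFunctor.obj (op R.BN.base)) := by
  haveI : IsCancelMul (S.tf.ratFnFunctor.obj (op R.BN.base)) :=
    isIntegral_iff_isCancelMul.mp (h.isGroupLike_rat R.BN.base).isPreDivisorial.isIntegral
  haveI hb : IsIso (ModelFrobenioid.baseMap R.pair.num) := R.pair.isPreStep_num.2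
  set 𝔉 := ofBiKummerData h toB Q odd_l R ιX hopen σ K' constEmb constEmb_injective hdivc hdivp with h𝔉
  set b := ModelFrobenioid.baseMap R.pair.num with hbdef
  set s : Aut R.BN := 𝔉.sgpCap (rhoOfBiKummerData R ιX y) with hsdef
  set hh : 𝔉.HB := ⟨rhoOfBiKummerData R ιX y, Subgroup.mem_map_of_mem _ hy⟩ with hhh
  set t : Aut R.BN := 𝔉.sgpCup hh with htdef
  set τ : Aut R.AN := σ (S.galoisSurj R.AN.base R.αData.isGalois (ιX y)) with hτ
  set x : S.tf.ratFnFunctor.obj (op R.AN.base) := (toB R.AN R.root : S.tf.ratFnFunctor.obj (op R.AN.base)) with hxdef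
  set xB : S.tf.ratFnFunctor.obj (op R.BN.base) :=
    (toB R.BN (S.restrictAlong R.pair.num R.pair.isPreStep_num R.root) : S.tf.ratFnFunctor.obj (op R.BN.base)) with hxBdef
  -- the sections at `y⁻¹` are the inverses
  have hyi : y⁻¹ ∈ T.PiYdd := inv_mem hy
  have hρ_inv : rhoOfBiKummerData R ιX y⁻¹ = (rhoOfBiKummerData R ιX y)⁻¹ := map_inv _ _
  have hcap_inv : 𝔉.sgpCap (rhoOfBiKummerData R ιX y⁻¹) = s⁻¹ :=
    (congrArg 𝔉.sgpCap hρ_inv).trans (map_inv 𝔉.sgpCap _)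
  have hhh_inv : (⟨rhoOfBiKummerData R ιX y⁻¹, Subgroup.mem_map_of_mem _ hyi⟩ : 𝔉.HB) = hh⁻¹ :=
    Subtype.ext (by exact hρ_inv)
  have hcup_inv : 𝔉.sgpCup ⟨rhoOfBiKummerData R ιX y⁻¹, Subgroup.mem_map_of_mem _ hyi⟩ = t⁻¹ :=
    (congrArg 𝔉.sgpCup hhh_inv).trans (map_inv 𝔉.sgpCup hh)
  have hτ_inv : σ (S.galoisSurj R.AN.base R.αData.isGalois (ιX y⁻¹)) = τ⁻¹ := by
    rw [map_inv, map_inv, map_inv]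
  -- my gen-3 Kummer identity at `y⁻¹`: `b^* u_{s⁻¹} · x = Base(τ⁻¹)^* x · b^* u_{t⁻¹}`
  have E := pull_unit_sgpCap_mul_root h toB Q odd_l R ιX hopen σ K' constEmb constEmb_injective hdivc hdivp hfrac y⁻¹ hyi
  rw [hcap_inv, hcup_inv, hτ_inv] at E
  change pull S.tf.ratFnFunctor b (ModelFrobenioid.unit s.inv) * x =
    pull S.tf.ratFnFunctor (ModelFrobenioid.baseMap τ.inv) x * pull S.tf.ratFnFunctor b (ModelFrobenioid.unit t.inv) at E
  -- bases: `b ≫ Base(s) = Base(τ) ≫ b` (the defining relation of `s^⊓-gp_N` at `ρ y`), `Base(t) = Base(s) = ρ y`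
  have hg' : 𝔉.autBaseIsoAB.symm (rhoOfBiKummerData R ιX y) = S.galoisSurj R.AN.base R.αData.isGalois (ιX y) :=
    ofBiKummerData_autBaseIsoAB_symm_ρ h toB Q odd_l R ιX hopen σ K' constEmb constEmb_injective hdivc hdivp y
  have c1 : R.pair.num ≫ s.hom = τ.hom ≫ R.pair.num := by
    have e := sgpCapSpec_ofBiKummerData h toB Q odd_l R ιX hopen σ K' constEmb constEmb_injective hdivc hdivp
      (rhoOfBiKummerData R ιX y)
    rw [hg'] at e
    exact e
  have hbase_s : ModelFrobenioid.baseMap s.hom = (rhoOfBiKummerData R ιX y).hom :=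
    congrArg Iso.hom (sgpCapSection_ofBiKummerData h toB Q odd_l R ιX hopen σ K' constEmb constEmb_injective hdivc hdivp hσ
      (rhoOfBiKummerData R ιX y))
  have hbase_t : ModelFrobenioid.baseMap t.hom = (rhoOfBiKummerData R ιX y).hom :=
    congrArg Iso.hom (sgpCupSection_ofBiKummerData h toB Q odd_l R ιX hopen σ K' constEmb constEmb_injective hdivc hdivp hσ hh)
  have hbase_ts : ModelFrobenioid.baseMap t.inv = ModelFrobenioid.baseMap s.inv := by
    have es : ModelFrobenioid.baseMap s.inv ≫ ModelFrobenioid.baseMap s.hom = 𝟙 _ := by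
      rw [← ModelFrobenioid.baseMap_comp, s.inv_hom_id, ModelFrobenioid.baseMap_id]
    have et : ModelFrobenioid.baseMap t.hom ≫ ModelFrobenioid.baseMap t.inv = 𝟙 _ := by
      rw [← ModelFrobenioid.baseMap_comp, t.hom_inv_id, ModelFrobenioid.baseMap_id]
    calc ModelFrobenioid.baseMap t.inv = 𝟙 _ ≫ ModelFrobenioid.baseMap t.inv := (Category.id_comp _).symm
      _ = (ModelFrobenioid.baseMap s.inv ≫ ModelFrobenioid.baseMap s.hom) ≫ ModelFrobenioid.baseMap t.inv := by rw [es]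
      _ = ModelFrobenioid.baseMap s.inv ≫ (ModelFrobenioid.baseMap t.hom ≫ ModelFrobenioid.baseMap t.inv) := by
          rw [Category.assoc, hbase_s, ← hbase_t]
      _ = ModelFrobenioid.baseMap s.inv := by rw [et, Category.comp_id]
  have hcomp : ModelFrobenioid.baseMap s.inv ≫ inv b = inv b ≫ ModelFrobenioid.baseMap τ.inv := by
    have eb : b ≫ ModelFrobenioid.baseMap s.hom = ModelFrobenioid.baseMap τ.hom ≫ b := by
      have e := congrArg ModelFrobenioid.baseMap c1
      rwa [ModelFrobenioid.baseMap_comp, ModelFrobenioid.baseMap_comp] at e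
    -- `b ≫ Base(s⁻¹) = Base(τ⁻¹) ≫ b`, then conjugate by `b⁻¹`
    have es : ModelFrobenioid.baseMap s.hom ≫ ModelFrobenioid.baseMap s.inv = 𝟙 _ := by
      rw [← ModelFrobenioid.baseMap_comp, s.hom_inv_id, ModelFrobenioid.baseMap_id]
    have eτ : ModelFrobenioid.baseMap τ.inv ≫ ModelFrobenioid.baseMap τ.hom = 𝟙 _ := by
      rw [← ModelFrobenioid.baseMap_comp, τ.inv_hom_id, ModelFrobenioid.baseMap_id]
    have hbs : b ≫ ModelFrobenioid.baseMap s.inv = ModelFrobenioid.baseMap τ.inv ≫ b := by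
      calc b ≫ ModelFrobenioid.baseMap s.inv
          = (ModelFrobenioid.baseMap τ.inv ≫ ModelFrobenioid.baseMap τ.hom) ≫ b ≫ ModelFrobenioid.baseMap s.inv := by
            rw [eτ, Category.id_comp]
        _ = ModelFrobenioid.baseMap τ.inv ≫ (ModelFrobenioid.baseMap τ.hom ≫ b) ≫ ModelFrobenioid.baseMap s.inv := by
            simp only [Category.assoc]
        _ = ModelFrobenioid.baseMap τ.inv ≫ b ≫ (ModelFrobenioid.baseMap s.hom ≫ ModelFrobenioid.baseMap s.inv) := by
            rw [← eb]; simp only [Category.assoc]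
        _ = ModelFrobenioid.baseMap τ.inv ≫ b := by rw [es, Category.comp_id]
    apply (cancel_epi b).mp
    rw [← Category.assoc, hbs, Category.assoc, IsIso.hom_inv_id, Category.comp_id, IsIso.hom_inv_id_assoc]
  -- unit bookkeeping: `u_{t⁻¹}` is the inverse of `Base(t⁻¹)^* u_t`, and `u_ω = Base(s⁻¹)^* u_t · u_{s⁻¹}`
  have U1 : pull S.tf.ratFnFunctor (ModelFrobenioid.baseMap t.inv) (ModelFrobenioid.unit t.hom) * ModelFrobenioid.unit t.inv = 1 := by
    have e0 := congrArg ModelFrobenioid.unit t.inv_hom_id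
    rwa [ModelFrobenioid.unit_comp_of_degFr_eq_one _ (ModelFrobenioid.degFr_eq_one_of_isIso _), ModelFrobenioid.unit_id] at e0
  have U2 : ModelFrobenioid.unit ((t * s⁻¹ : Aut R.BN).hom) =
      pull S.tf.ratFnFunctor (ModelFrobenioid.baseMap s.inv) (ModelFrobenioid.unit t.hom) * ModelFrobenioid.unit s.inv := by
    change ModelFrobenioid.unit (s.inv ≫ t.hom) = _
    rw [ModelFrobenioid.unit_comp_of_degFr_eq_one _ (ModelFrobenioid.degFr_eq_one_of_isIso _)]
  -- the computation
  have LHS : (toB R.BN (S.biratAut R.BN s (S.restrictAlong R.pair.num R.pair.isPreStep_num R.root)) :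
      S.tf.ratFnFunctor.obj (op R.BN.base)) =
      pull S.tf.ratFnFunctor (inv b) (pull S.tf.ratFnFunctor (ModelFrobenioid.baseMap τ.inv) x) := by
    rw [haut, hres, ← pull_comp, hcomp, pull_comp]
  have hxB : xB = pull S.tf.ratFnFunctor (inv b) x := hres R.pair.num R.pair.isPreStep_num R.root
  have hbb : ∀ z : S.tf.ratFnFunctor.obj (op R.BN.base), pull S.tf.ratFnFunctor (inv b) (pull S.tf.ratFnFunctor b z) = z := by
    intro z
    rw [← pull_comp, IsIso.inv_hom_id, pull_id]
  apply mul_right_cancel (b := ModelFrobenioid.unit t.inv)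
  rw [LHS]
  calc pull S.tf.ratFnFunctor (inv b) (pull S.tf.ratFnFunctor (ModelFrobenioid.baseMap τ.inv) x) * ModelFrobenioid.unit t.inv
      = pull S.tf.ratFnFunctor (inv b) (pull S.tf.ratFnFunctor (ModelFrobenioid.baseMap τ.inv) x) *
          pull S.tf.ratFnFunctor (inv b) (pull S.tf.ratFnFunctor b (ModelFrobenioid.unit t.inv)) := by rw [hbb]
    _ = pull S.tf.ratFnFunctor (inv b) (pull S.tf.ratFnFunctor b (ModelFrobenioid.unit s.inv) * x) := by rw [← map_mul, ← E]
    _ = ModelFrobenioid.unit s.inv * xB := by rw [map_mul, hbb, hxB]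
    _ = ModelFrobenioid.unit s.inv * xB *
          (pull S.tf.ratFnFunctor (ModelFrobenioid.baseMap t.inv) (ModelFrobenioid.unit t.hom) * ModelFrobenioid.unit t.inv) := by
          rw [U1, mul_one]
    _ = ModelFrobenioid.unit ((t * s⁻¹ : Aut R.BN).hom) * xB * ModelFrobenioid.unit t.inv := by
          rw [U2, hbase_ts]
          exact mul_mul_mul_comm4 _ _ _ _

/-- **Uniqueness of the Kummer multiplier** (assembled data): a unit `ζ ∈ O^×(B_N)` with `s^⊓-gp_N(ρ y)·g_B = u_ζ·g_B` IS the
bi-Kummer difference `ω_y` — `B(B_N^bs)` is cancellative and `O^×(B_N) ↪ B(B_N^bs)`, `ζ ↦ u_ζ` is injective (`Φ` divisorial, [FrdI]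
Thm. 5.2 (ii)); so the root function DETERMINES the bi-Kummer difference cocycle (Prop. 4.3 (iii) «In particular, this cohomology class is
independent of … conjugation»).  [cite: MochizukiEtTh2009, Prop 4.3 (iii) p.317 (PDF p.91); §5 p.331 (PDF p.105)] -/
theorem eq_sgpCup_mul_sgpCap_inv_of_mul_restrict_ofBiKummerData
    (hσ : ∀ g : Aut R.AN.base, ModelFrobenioid.baseMap (σ g).hom = g.hom)
    (hfrac : ∀ {A B : S.C} (s' s'' : A ⟶ B) (h' : S.IsPreStep s') (h'' : S.IsPreStep s'')
      (hb : PreFrobenioid.BaseEquivalent S.F s' s''),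
      (toB A (S.fracOf s' s'' h' h'' hb) : S.tf.ratFnFunctor.obj (op A.base)) *
        ModelFrobenioid.unit s'' = ModelFrobenioid.unit s')
    (haut : ∀ {A : S.C} (e : Aut A) (x : S.biratUnits A),
      (toB A (S.biratAut A e x) : S.tf.ratFnFunctor.obj (op A.base)) =
        pull S.tf.ratFnFunctor (ModelFrobenioid.baseMap e.inv) (toB A x : S.tf.ratFnFunctor.obj (op A.base)))
    (hres : ∀ {A B : S.C} (s : A ⟶ B) (hs : S.IsPreStep s) (x : S.biratUnits A),
      haveI : IsIso (ModelFrobenioid.baseMap s) := hs.2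
      (toB B (S.restrictAlong s hs x) : S.tf.ratFnFunctor.obj (op B.base)) =
        pull S.tf.ratFnFunctor (inv (ModelFrobenioid.baseMap s)) (toB A x : S.tf.ratFnFunctor.obj (op A.base)))
    (y : T.PiX) (hy : y ∈ T.PiYdd) (ζ : Aut R.BN)
    (hζ : ζ ∈ (ofBiKummerData h toB Q odd_l R ιX hopen σ K' constEmb constEmb_injective hdivc hdivp).units
      (ofBiKummerData h toB Q odd_l R ιX hopen σ K' constEmb constEmb_injective hdivc hdivp).BN)
    (e : (toB R.BN (S.biratAut R.BN
        ((ofBiKummerData h toB Q odd_l R ιX hopen σ K' constEmb constEmb_injective hdivc hdivp).sgpCap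
          (rhoOfBiKummerData R ιX y))
        (S.restrictAlong R.pair.num R.pair.isPreStep_num R.root)) : S.tf.ratFnFunctor.obj (op R.BN.base)) =
      (ModelFrobenioid.unit ζ.hom : S.tf.ratFnFunctor.obj (op R.BN.base)) *
        (toB R.BN (S.restrictAlong R.pair.num R.pair.isPreStep_num R.root) : S.tf.ratFnFunctor.obj (op R.BN.base))) :
    ζ = (ofBiKummerData h toB Q odd_l R ιX hopen σ K' constEmb constEmb_injective hdivc hdivp).sgpCup
          ⟨rhoOfBiKummerData R ιX y, Subgroup.mem_map_of_mem _ hy⟩ *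
        ((ofBiKummerData h toB Q odd_l R ιX hopen σ K' constEmb constEmb_injective hdivc hdivp).sgpCap
          (rhoOfBiKummerData R ιX y))⁻¹ := by
  haveI : IsCancelMul (S.tf.ratFnFunctor.obj (op R.BN.base)) :=
    isIntegral_iff_isCancelMul.mp (h.isGroupLike_rat R.BN.base).isPreDivisorial.isIntegral
  set 𝔉 := ofBiKummerData h toB Q odd_l R ιX hopen σ K' constEmb constEmb_injective hdivc hdivp with h𝔉
  have hω : 𝔉.sgpCup ⟨rhoOfBiKummerData R ιX y, Subgroup.mem_map_of_mem _ hy⟩ *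
      (𝔉.sgpCap (rhoOfBiKummerData R ιX y))⁻¹ ∈ 𝔉.units 𝔉.BN :=
    sgpCup_mul_sgpCap_inv_mem_units 𝔉
      (sgpCapSection_ofBiKummerData h toB Q odd_l R ιX hopen σ K' constEmb constEmb_injective hdivc hdivp hσ)
      (sgpCupSection_ofBiKummerData h toB Q odd_l R ιX hopen σ K' constEmb constEmb_injective hdivc hdivp hσ) _
  rw [toB_biratAut_sgpCap_restrict_ofBiKummerData h toB Q odd_l R ιX hopen σ K' constEmb constEmb_injective hdivc hdivp hσ
    hfrac haut hres y hy] at e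
  have hu : ModelFrobenioid.unit ζ.hom = ModelFrobenioid.unit (𝔉.sgpCup ⟨rhoOfBiKummerData R ιX y,
      Subgroup.mem_map_of_mem _ hy⟩ * (𝔉.sgpCap (rhoOfBiKummerData R ιX y))⁻¹).hom := (mul_right_cancel e).symm
  have key : ModelFrobenioid.unitsToRatFn 𝔉.BN ⟨ζ, hζ⟩ = ModelFrobenioid.unitsToRatFn 𝔉.BN ⟨_, hω⟩ :=
    Units.ext hu
  exact congrArg Subtype.val
    (ModelFrobenioid.unitsToRatFn_injective (h.isDivisorial R.BN.base).isPreDivisorial.isIntegral key)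

end Assembled

/-! ## §2. Generic bookkeeping: `diffCocycle` and the print orientation (any §5 data `𝔉`) -/

section Generic

universe uC vC uD vD

variable {C : Type uC} [Category.{vC} C] {D : Type uD} [Category.{vD} D] (𝔉 : ThetaFrobenioid.{w} C D)

/-- abc-iut-L2-t11's `diffCocycle H k`, as an automorphism of `B_N`, is `s^⊔-gp_N(ρ k)·s^⊓-gp_N(ρ k)⁻¹` (definitional unfolding, recorded
so that consumers at heavy carriers rewrite instead of unfolding).  [cite: MochizukiEtTh2009, Prop 5.2 (iii) p.324 (PDF p.98)] -/
theorem coe_diffCocycle_eq (H : 𝔉.Facts) (k : 𝔉.PiYdd) :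
    ((𝔉.diffCocycle H k : 𝔉.muTorsion 𝔉.BN 𝔉.N) : Aut 𝔉.BN) =
      𝔉.sgpCup ⟨𝔉.ρ k, Subgroup.mem_map_of_mem _ k.2⟩ * (𝔉.sgpCap (𝔉.ρ k))⁻¹ := rfl

/-- **F-0521 pointwise, solved for the bi-Kummer difference**: `ThetaSectionCompat H T ι m hYdd η` iff for every `k ∈ Π^tp_Ÿ`,
`s^⊔-gp_N(ρ k)·s^⊓-gp_N(ρ k)⁻¹ = m⁻¹(η(ι k))⁻¹` in `Aut_C(B_N)` (pure bookkeeping on abc-iut-L2-t11's definition).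
[cite: MochizukiEtTh2009, Prop 5.2 (iii) p.324 (PDF p.98)] -/
theorem thetaSectionCompat_iff_forall_coe (H : 𝔉.Facts) (T : ThetaEnvData.{vC} 𝔉.N) (ι : 𝔉.PiX ≃* T.PiX)
    (m : 𝔉.muTorsion 𝔉.BN 𝔉.N ≃* T.mu) (hYdd : 𝔉.IdentifiesPiYdd T ι) (η : T.PiYdd → T.mu) :
    𝔉.ThetaSectionCompat H T ι m hYdd η ↔
      ∀ k : 𝔉.PiYdd, (((m.symm (η ⟨ι k, (hYdd k).mp k.2⟩))⁻¹ : 𝔉.muTorsion 𝔉.BN 𝔉.N) : Aut 𝔉.BN) =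
        𝔉.sgpCup ⟨𝔉.ρ k, Subgroup.mem_map_of_mem _ k.2⟩ * (𝔉.sgpCap (𝔉.ρ k))⁻¹ := by
  refine forall_congr' fun k => ?_
  rw [← coe_diffCocycle_eq, ← map_inv]
  constructor
  · intro hk
    rw [← hk, MulEquiv.symm_apply_apply]
  · intro hk
    have hk' : m.symm (η ⟨ι k, (hYdd k).mp k.2⟩)⁻¹ = 𝔉.diffCocycle H k := Subtype.ext hk
    rw [← hk', MulEquiv.apply_symm_apply]

/-- **Prop. 5.2 (iii) in print's orientation** (the lead's R-C3 wording «`s^⊓-gp_N·s^⊔-gp_N⁻¹ = ρ_N^* η^Θ_N` in `μ_N(B_N)` via [the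
identification `m`]»), for ANY §5 data: from F-0521, for every `k ∈ Π^tp_Ÿ`, `s^⊓-gp_N(ρ k)·s^⊔-gp_N(ρ k)⁻¹ = m⁻¹(η(ι k))` in `Aut_C(B_N)`
(orientation bookkeeping: abc-iut-L2-t11's `diffCocycle = s^⊔-gp·s^⊓-gp⁻¹`).  `m` is generic; a consumer may take Prop. 5.5's identification.
[cite: MochizukiEtTh2009, Prop 5.2 (iii) p.324 (PDF p.98); Prop 5.5 p.327 (PDF p.101)] -/
theorem sgpCap_mul_sgpCup_inv_eq_of_thetaSectionCompat (H : 𝔉.Facts) (T : ThetaEnvData.{vC} 𝔉.N) (ι : 𝔉.PiX ≃* T.PiX)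
    (m : 𝔉.muTorsion 𝔉.BN 𝔉.N ≃* T.mu) (hYdd : 𝔉.IdentifiesPiYdd T ι) {η : T.PiYdd → T.mu}
    (hc : 𝔉.ThetaSectionCompat H T ι m hYdd η) (k : 𝔉.PiYdd) :
    𝔉.sgpCap (𝔉.ρ k) * (𝔉.sgpCup ⟨𝔉.ρ k, Subgroup.mem_map_of_mem _ k.2⟩)⁻¹ =
      ((m.symm (η ⟨ι k, (hYdd k).mp k.2⟩) : 𝔉.muTorsion 𝔉.BN 𝔉.N) : Aut 𝔉.BN) := by
  have hk := ((𝔉.thetaSectionCompat_iff_forall_coe H T ι m hYdd η).mp hc k).symm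
  rw [Subgroup.coe_inv] at hk
  rw [← inv_inv ((m.symm (η ⟨ι k, (hYdd k).mp k.2⟩) : 𝔉.muTorsion 𝔉.BN 𝔉.N) : Aut 𝔉.BN), ← hk, mul_inv_rev, inv_inv]

end Generic

end ThetaFrobenioid

end Literature.AnabelianGeometry.EtaleTheta

end
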